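import Literature.NumberTheory.Transcendental.DiazThm1FromCh8
import Literature.NumberTheory.Transcendental.DiazThm2Proofs
import HarnessLib

/-!
# Diaz 1989, Théorème 2 from Corollary 1.1 of LNM 1752, Ch. 8 (Philippon's criterion) and the zero lemma

Topic `Literature/NumberTheory/Transcendental`. Companion of `DiazThm2Proofs.lean` (the reduction
`Philippon1986_mainCriterion → Diaz1989_zeroLemma → Diaz1989_thm2`) in the same way as
`DiazThm1FromCh8.lean` is the companion of `DiazThm1Proofs.lean`: the criterion leaf is replaced
by Philippon's criterion in the form of LNM 1752 Ch. 8 Corollary 1.1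
(`NesterenkoPhilippon2001_ch8_cor_1_1`, `PhilipponCriterionCh8.lean`), through the projective
transfer of `DiazThm1FromCh8.lean` (namespace `Ch8Transfer`: homogenisation `homog`, the bounds
`formNorm_le_sum_abs_coeff`, `inv_pow_le_formNorm_sq`, and `polydisc_of_sineDist_le`), applied to
the family of `DiazThm2Proofs.lean` (`DiazThm2.GoodX`, `DiazThm2.famPoly`: the `D = 1`
construction, which does not involve the variables `Y_k`) at the projective point
`x = (1 : θ'')`, `θ'' = (0, …, 0, e^{u_hv_k})`. Main results (everything here is proved):

* `le_trdeg_of_eventually_goodX_ch8'` — the exponent-free form: if all large `X` are good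
  (`DiazThm2.GoodX`), then `trdeg_ℚ ℚ(e^{u_hv_k}) ≥ [mn/(m+n)]`;
* `Diaz1989_thm2_of_ch8 : NesterenkoPhilippon2001_ch8_cor_1_1 → Diaz1989_zeroLemma → Diaz1989_thm2`;
* `Diaz1989_thm2_of_ch8_P1n : NesterenkoPhilippon2001_ch8_cor_1_1 → Philippon1986_GaGm_P1n →
  Diaz1989_thm2`, and the same for `Diaz1989_grid` (LNM 1752 Ch. 14 Thm 2.7, clause `t`).

So the open leaves of `largeTranscendenceDegree_of_ch8_leaves`
(`Literature/Barriers/Schanuel/LargeTranscendenceDegreeProofs.lean`) may now be taken to be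
{Ch. 8 Cor. 1.1, Philippon's zero estimate on `𝔾ₐ × 𝔾ₘⁿ`, `Philippon1986_thm_2_12`}.

The growth functions are those of `DiazThm1FromCh8.lean` with `Φ = X^{m+n}`, `Ψ = X^{mn} log X`,
`c_S`, `c_δ` of `DiazThm2Smallness.lean`, `ρ = 16(n+1)Ψ`, `Ψ(X+1) ≤ 2^{mn+1}Ψ(X)`, and
`k + 1 = [mn/(m+n)]` (`U/(τδᵏσ^{k+1}) ≍ Ψ/Φ^{k+1} → ∞` by `DiazThm2.eventually_Phq_pow_le_Psq`);
the only new point is again that values and zeros of the family are read off at `θ''` resp.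
transported to the ball around `θ = (v_k, e^{u_hv_k})` through `DiazThm2.aeval_famPoly_congr`.

## References

* G. Diaz, *Grands degrés de transcendance pour des familles d'exponentielles*, J. Number Theory
  31 (1989), 1–23, Théorème 2 (p. 2), §II-4-3 (p. 16).
* Yu. V. Nesterenko, P. Philippon (eds.), *Introduction to Algebraic Independence Theory*,
  LNM 1752, Springer 2001, Ch. 8 §1 Corollary 1.1 (PDF pp. 165–166); Ch. 14 Thm 2.7 (p. 248).
-/

noncomputable section

open MvPolynomial Filter Finset

namespace Literature.NumberTheory.Transcendental

section Assembly

open Real Literature.NumberTheory.Transcendental.Asymp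
  Literature.NumberTheory.Transcendental.Chudnovsky DiazThm2 Ch8Transfer Philippon

open DiazThm1 (Var theta varEquiv l1_rename_of_injective trdeg_adjoin_congr three_le_X
  scale_add_one_le one_le_scale exists_zeroLemmaAt)

set_option maxHeartbeats 1600000 in
/-- **Diaz 1989, Théorème 2, §II-4-3 (the conclusion) through LNM 1752 Ch. 8 Corollary 1.1,
exponent-free form.** If all large `X` are good for `u ∈ ℂⁿ`, `v ∈ ℂ^{m'+1}` (`DiazThm2.GoodX`: Siegel's
step applies with `D = 1`, the family `𝓕_X` of the `Q_{μj}` is small at `θ = (v_k, e^{u_hv_k})`, has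
degrees and logarithmic lengths `≤ c_δΦ(X)`, and no common zero in the polydisc of radius
`e^{-ρ(X)}` around `θ`) and `mn > m + n`, then Ch. 8 Cor. 1.1 applied at `x = (1 : θ'')`,
`θ'' = (0, …, 0, e^{u_hv_k})`, to the homogenised family gives `trdeg_ℚ ℚ(e^{u_hv_k}) ≥ [mn/(m+n)]`.
[cite: Diaz1989, Théorème 2 p. 2; §II-4-3 p. 16]
[cite: NesterenkoPhilippon2001, Ch. 8 §1 Corollary 1.1 (PDF pp. 165–166)] -/
theorem le_trdeg_of_eventually_goodX_ch8' (hC : NesterenkoPhilippon2001_ch8_cor_1_1) {m' n : ℕ}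
    (hmn : (m' + 1) + n < (m' + 1) * n) (u : Fin n → ℂ) (v : Fin (m' + 1) → ℂ)
    (hgood : ∀ᶠ X in atTop, GoodX u v X) :
    (((((m' + 1) * n) / ((m' + 1) + n) : ℕ)) : Cardinal) ≤ Algebra.trdeg ℚ
        ↥(IntermediateField.adjoin ℚ
          (Set.range fun p : Fin n × Fin (m' + 1) => Complex.exp (u p.1 * v p.2))) := by
  have hm1 : 1 ≤ m' + 1 := by omega
  have hmn1 : 1 ≤ (m' + 1) + n := by omega
  -- the exponent `k + 1 = [mn/(m+n)]`
  obtain ⟨hk1, hk⟩ := exponent_facts (m := m' + 1) (n := n) hmn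
  set k : ℕ := ((m' + 1) * n) / ((m' + 1) + n) - 1 with hkdef
  -- the transported point `θ'' ∈ ℂ^q` and the projective point `x = (1 : θ'')`
  set eV := varEquiv (m' + 1) n with heV
  set q : ℕ := (m' + 1) + n * (m' + 1) with hqdef
  set θ₀ : Var (m' + 1) n → ℂ :=
    Sum.elim (fun _ => (0 : ℂ)) (fun p : Fin n × Fin (m' + 1) => Complex.exp (u p.1 * v p.2)) with hθ₀
  set θq : Fin q → ℂ := θ₀ ∘ eV.symm with hθq
  have hθ₀inr : ∀ p, θ₀ (Sum.inr p) = theta u v (Sum.inr p) := fun p => by simp [hθ₀]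
  have hkq : k ≤ q := by
    have h1 : (m' + 1) * n / ((m' + 1) + n) ≤ (m' + 1) * n := Nat.div_le_self _ _
    have h2 : (m' + 1) * n = n * (m' + 1) := Nat.mul_comm _ _
    omega
  set xP : Fin (q + 1) → ℂ := Fin.cons 1 θq with hxP
  have hxP0 : xP 0 = 1 := by simp [hxP]
  have hx1 : 1 ≤ projNorm xP := by
    have := norm_apply_le_projNorm xP 0
    rwa [hxP0, norm_one] at this
  have hxpos : 0 < projNorm xP := by linarith
  -- constants
  have hcS := cSq_pos (m := m' + 1) (n := n) hmn
  have hcd1 : (1 : ℝ) ≤ cdq (m' + 1) n := one_le_cdq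
  have hcd0 : (0 : ℝ) < cdq (m' + 1) n := by linarith
  set g' : ℝ := (2 : ℝ) ^ (((m' + 1 : ℕ) : ℝ) * n + 1) with hg'
  have hg'1 : 1 ≤ g' := Real.one_le_rpow (by norm_num) (by positivity)
  set Lx : ℝ := |Real.log (2 * projNorm xP)| with hLx
  set Lx2 : ℝ := |Real.log (2 * projNorm xP ^ 2)| with hLx2
  set σ₀ : ℝ := 1 + 2 * Lx + 2 / cSq (m' + 1) n * (16 * ((n : ℝ) + 1) * g' + Lx2) with hσ₀
  have hLx0 : 0 ≤ Lx := abs_nonneg _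
  have hLx20 : 0 ≤ Lx2 := abs_nonneg _
  have hσ₀1 : 1 ≤ σ₀ := by
    have : 0 ≤ 2 / cSq (m' + 1) n * (16 * ((n : ℝ) + 1) * g' + Lx2) := by positivity
    linarith
  have hσ₀0 : 0 ≤ σ₀ := by linarith
  set Lq' : ℝ := Real.log ((q : ℝ) + 1) with hLq
  have hLq0 : 0 ≤ Lq' := Real.log_nonneg (by simp)
  set A : ℝ := 2 / cSq (m' + 1) n * (Lq' * cdq (m' + 1) n + cdq (m' + 1) n + σ₀ ^ (k + 1) + 2)
    with hAdef
  have hA0 : 0 ≤ A := by positivity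
  -- thresholds: every `X ≥ X₀` is good, `A Φ^{k+1} ≤ Ψ`, `X ≥ e` and `X ≥ σ₀^{k+1} + 1`
  have hev := hgood.and
    ((eventually_Phq_pow_le_Psq (m := m' + 1) (n := n) hk A).and
      (eventually_ge_atTop (max (Real.exp 1) (σ₀ ^ (k + 1) + 1))))
  obtain ⟨X₀, hX₀⟩ := Filter.eventually_atTop.mp hev
  set N₁ : ℕ := ⌈max X₀ 0⌉₊ + 3 with hN₁def
  have hN₁3 : 3 ≤ N₁ := by omega
  have hXN : ∀ N : ℕ, X₀ ≤ (N : ℝ) + N₁ := fun N => by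
    have h1 : X₀ ≤ ⌈max X₀ 0⌉₊ := (le_max_left _ _).trans (Nat.le_ceil _)
    have h2 : (N₁ : ℝ) = (⌈max X₀ 0⌉₊ : ℝ) + 3 := by rw [hN₁def]; push_cast; ring
    have h3 : (0 : ℝ) ≤ N := Nat.cast_nonneg N
    linarith
  have hG : ∀ N : ℕ, GoodX u v ((N : ℝ) + N₁) := fun N => (hX₀ _ (hXN N)).1
  have hXe : ∀ N : ℕ, Real.exp 1 ≤ (N : ℝ) + N₁ := fun N =>
    (le_max_left _ _).trans (hX₀ _ (hXN N)).2.2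
  have hX1 : ∀ N : ℕ, (1 : ℝ) ≤ (N : ℝ) + N₁ := fun N =>
    le_trans (by have := Real.add_one_le_exp (1 : ℝ); linarith) (hXe N)
  have hX2 : ∀ N : ℕ, (2 : ℝ) ≤ (N : ℝ) + N₁ := fun N => by linarith [(hG N).three_le]
  have hΦ1 : ∀ N : ℕ, 1 ≤ Phq (m' + 1) n ((N : ℝ) + N₁) := fun N =>
    one_le_Phq (m := m' + 1) (n := n) hmn1 (hX1 N)
  have hΨ1 : ∀ N : ℕ, 1 ≤ Psq (m' + 1) n ((N : ℝ) + N₁) := fun N =>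
    one_le_scale (by positivity) zero_le_one (hXe N)
  have hE2 : ∀ N : ℕ, A * Phq (m' + 1) n ((N : ℝ) + N₁) ≤ Psq (m' + 1) n ((N : ℝ) + N₁) :=
    fun N => by
    have h := (hX₀ _ (hXN N)).2.1
    refine le_trans (mul_le_mul_of_nonneg_left ?_ hA0) h
    exact le_self_pow₀ (hΦ1 N) (Nat.succ_ne_zero k)
  have hE3 : ∀ N : ℕ, σ₀ ^ (k + 1) + 1 ≤ cdq (m' + 1) n * Phq (m' + 1) n ((N : ℝ) + N₁) :=
    fun N => by
    have h1 : σ₀ ^ (k + 1) + 1 ≤ (N : ℝ) + N₁ := (le_max_right _ _).trans (hX₀ _ (hXN N)).2.2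
    have h2 : (N : ℝ) + N₁ ≤ Phq (m' + 1) n ((N : ℝ) + N₁) :=
      X_le_Phq (m := m' + 1) (n := n) hmn1 (hX1 N)
    have h3 : Phq (m' + 1) n ((N : ℝ) + N₁) ≤ cdq (m' + 1) n * Phq (m' + 1) n ((N : ℝ) + N₁) :=
      le_mul_of_one_le_left (by linarith [hΦ1 N]) hcd1
    linarith
  -- the growth functions
  set δF : ℕ → ℝ := sigF (m' + 1) n N₁ with hδF
  set τF : ℕ → ℝ := fun j => δF j + (σ₀ ^ (k + 1) + 1) with hτF
  set UF : ℕ → ℝ := fun j => SF (m' + 1) n N₁ j * (1 / 2) with hUF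
  have hδF1 : ∀ j, 1 ≤ δF j := fun j => one_le_sigF hN₁3 hmn1 j
  have hUF : ∀ j, UF j = cSq (m' + 1) n * Psq (m' + 1) n ((j : ℝ) + N₁) / 2 := fun j => by
    simp only [hUF, SF]; ring
  have hUFhalf : ∀ j, 1 / 2 ≤ UF j := fun j => by
    rw [hUF]; linarith [(hG j).S_ge]
  have hτU : ∀ j, τF j < UF j := fun j => by
    have h := hE2 j
    simp only [hτF, hδF, sigF]
    rw [hUF]
    have hΦ := hΦ1 j
    have hA' : A * Phq (m' + 1) n ((j : ℝ) + N₁) ≥ 2 / cSq (m' + 1) n *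
        (cdq (m' + 1) n * Phq (m' + 1) n ((j : ℝ) + N₁) + σ₀ ^ (k + 1) + 2) := by
      rw [hAdef, mul_assoc]
      refine mul_le_mul_of_nonneg_left ?_ (by positivity)
      have hσk : 0 ≤ σ₀ ^ (k + 1) := by positivity
      nlinarith [mul_nonneg hLq0 hcd0.le]
    have key : 2 / cSq (m' + 1) n *
        (cdq (m' + 1) n * Phq (m' + 1) n ((j : ℝ) + N₁) + σ₀ ^ (k + 1) + 2) ≤
        Psq (m' + 1) n ((j : ℝ) + N₁) := le_trans hA' h
    rw [div_mul_eq_mul_div, div_le_iff₀ hcS] at key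
    nlinarith
  -- the criterion
  have main := hC q k xP δF τF (fun _ => σ₀) UF hkq (by rw [hxP0]; exact one_ne_zero)
    (sigF_mono hN₁3) ((sigF_mono hN₁3).add_const _) monotone_const
    ((SF_mono hN₁3).mul_const (by norm_num)) hδF1 (fun _ => hσ₀1)
    (fun j => le_add_of_nonneg_right (by positivity))
    (fun j => by simp only [hτF]; linarith [hδF1 j])
    hτU ?ratio ?tendτ ?family
  case ratio =>
    set B : ℝ := 4 * σ₀ ^ (k + 1) * cdq (m' + 1) n ^ (k + 1) / cSq (m' + 1) n with hB
    have hB0 : 0 < B := by positivity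
    have hlow : ∀ j : ℕ, Psq (m' + 1) n ((j : ℝ) + N₁) / (B * Phq (m' + 1) n ((j : ℝ) + N₁) ^ (k + 1))
        ≤ UF j / (τF j * δF j ^ k * σ₀ ^ (k + 1)) := by
      intro j
      have hΦ := hΦ1 j
      have hΦ0 : 0 < Phq (m' + 1) n ((j : ℝ) + N₁) := by linarith
      have hτ2 : τF j ≤ 2 * δF j := by
        simp only [hτF, hδF, sigF]; linarith [hE3 j]
      have hτ0 : 0 < τF j := by simp only [hτF]; linarith [hδF1 j, pow_nonneg hσ₀0 (k + 1)]
      have hden : 0 < τF j * δF j ^ k * σ₀ ^ (k + 1) := by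
        have := hδF1 j; positivity
      rw [div_le_div_iff₀ (by positivity) hden, hUF]
      have hδ0 : 0 ≤ δF j := by linarith [hδF1 j]
      calc Psq (m' + 1) n ((j : ℝ) + N₁) * (τF j * δF j ^ k * σ₀ ^ (k + 1))
          ≤ Psq (m' + 1) n ((j : ℝ) + N₁) * (2 * δF j * δF j ^ k * σ₀ ^ (k + 1)) := by
            refine mul_le_mul_of_nonneg_left ?_ (by linarith [hΨ1 j])
            gcongr
        _ = cSq (m' + 1) n * Psq (m' + 1) n ((j : ℝ) + N₁) / 2 *
            (B * Phq (m' + 1) n ((j : ℝ) + N₁) ^ (k + 1)) := by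
            simp only [hδF, sigF, hB]
            field_simp
            ring
    have hf : Tendsto (fun j : ℕ => Psq (m' + 1) n ((j : ℝ) + N₁) /
        (B * Phq (m' + 1) n ((j : ℝ) + N₁) ^ (k + 1))) atTop atTop := by
      refine Filter.tendsto_atTop.mpr fun b => ?_
      have hev' := (eventually_Phq_pow_le_Psq (m := m' + 1) (n := n) hk (max b 0 * B)).and
        (eventually_ge_atTop (Real.exp 1))
      have := (tendsto_natCast_add_atTop N₁).eventually hev'
      filter_upwards [this] with j hj
      obtain ⟨hj, hje⟩ := hj
      have hΦ : 1 ≤ Phq (m' + 1) n ((j : ℝ) + N₁) :=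
        one_le_Phq (m := m' + 1) (n := n) hmn1
          (le_trans (by have := Real.add_one_le_exp (1 : ℝ); linarith) hje)
      have hpos : 0 < B * Phq (m' + 1) n ((j : ℝ) + N₁) ^ (k + 1) := by positivity
      rw [le_div_iff₀ hpos]
      calc b * (B * Phq (m' + 1) n ((j : ℝ) + N₁) ^ (k + 1))
          ≤ max b 0 * (B * Phq (m' + 1) n ((j : ℝ) + N₁) ^ (k + 1)) :=
            mul_le_mul_of_nonneg_right (le_max_left _ _) hpos.le
        _ = max b 0 * B * Phq (m' + 1) n ((j : ℝ) + N₁) ^ (k + 1) := by ring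
        _ ≤ _ := hj
    exact tendsto_atTop_mono hlow hf
  case tendτ =>
    refine tendsto_atTop_mono (fun j => ?_) (tendsto_natCast_add_atTop N₁)
    simp only [hτF, hδF]
    have h1 := X_le_sigF (m := m' + 1) (n := n) hN₁3 hmn1 j
    have h2 : 0 ≤ σ₀ ^ (k + 1) + 1 := by positivity
    linarith
  case family =>
    intro j
    have hGj := hG j
    set Xj : ℝ := (j : ℝ) + N₁ with hXj
    refine ⟨Fintype.card (FamIdx (m' + 1) n Xj), fun l =>
      homog (rename eV (famPoly u v Xj ((Fintype.equivFin _).symm l))), ?_, ?_, ?_, ?_, ?_⟩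
    · intro l
      dsimp only
      rw [totalDegree_homog]
      exact isHomogeneous_homog _
    · intro l
      dsimp only
      rw [totalDegree_homog]
      refine le_trans ?_ (hGj.degLen_famPoly ((Fintype.equivFin _).symm l)).1
      exact_mod_cast totalDegree_rename_le _ _
    · -- heights: `log ‖ʰQ‖ ≤ log L(Q) ≤ c_δΦ ≤ τ`
      intro l
      dsimp only
      set P := famPoly u v Xj ((Fintype.equivFin _).symm l) with hP
      have hτ1 : δF j ≤ τF j := le_add_of_nonneg_right (by positivity)
      have hlen : Real.log (l1 P) ≤ δF j := (hGj.degLen_famPoly ((Fintype.equivFin _).symm l)).2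
      unfold formLogHeight
      rcases (formNorm_nonneg (homog (rename eV P))).eq_or_lt with h0 | hpos
      · rw [← h0, Real.log_zero]; linarith [hδF1 j]
      · have hle : formNorm (homog (rename eV P)) ≤ l1 P := by
          refine (formNorm_le_sum_abs_coeff _).trans ?_
          rw [sum_abs_coeff_homog, ← l1_eq_sum_abs, l1_rename_of_injective eV.injective]
        exact ((Real.log_le_log hpos hle).trans hlen).trans hτ1
    · -- values (read off at `θ''`, equal to the values at `θ`)
      intro l
      dsimp only
      set P := famPoly u v Xj ((Fintype.equivFin _).symm l) with hP
      set H := homog (rename eV P) with hH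
      have hθ : θq ∘ eV = θ₀ := by funext x; simp [hθq]
      have hval : aeval xP H = aeval (theta u v) P := by
        rw [hH, hxP, aeval_homog_cons_one, aeval_rename, hθ]
        exact aeval_famPoly_congr (fun p => hθ₀inr p) _
      have hsmall : ‖aeval (theta u v) P‖ ≤ Real.exp (-(cSq (m' + 1) n * Psq (m' + 1) n Xj)) :=
        hGj.small_famPoly _
      by_cases hH0 : H = 0
      · rw [hH0, map_zero, norm_zero, zero_div]; exact (Real.exp_pos _).le
      · have hHhom : H.IsHomogeneous H.totalDegree := by
          rw [hH, totalDegree_homog]; exact isHomogeneous_homog _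
        have hq1 : 1 ≤ q + 1 := by omega
        have hlow := inv_pow_le_formNorm_sq hHhom hH0 hq1
        have hFpos : 0 < formNorm H := by
          rcases (formNorm_nonneg H).eq_or_lt with h0 | h
          · exfalso
            rw [← h0] at hlow
            have : (0 : ℝ) < (((q + 1 : ℕ) : ℝ) ^ H.totalDegree)⁻¹ := by positivity
            linarith
          · exact h
        have hden : 0 < formNorm H * projNorm xP ^ H.totalDegree := by positivity
        rw [div_le_iff₀ hden, hval]
        refine hsmall.trans ?_
        have hxd : 1 ≤ projNorm xP ^ H.totalDegree := one_le_pow₀ hx1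
        have hdeg : (H.totalDegree : ℝ) ≤ cdq (m' + 1) n * Phq (m' + 1) n Xj := by
          rw [hH, totalDegree_homog]
          refine le_trans ?_ (hGj.degLen_famPoly ((Fintype.equivFin _).symm l)).1
          exact_mod_cast totalDegree_rename_le _ _
        have hdl : (H.totalDegree : ℝ) * Lq' ≤ cSq (m' + 1) n * Psq (m' + 1) n Xj := by
          have h := hE2 j
          have hA' : 2 / cSq (m' + 1) n * (Lq' * cdq (m' + 1) n) * Phq (m' + 1) n Xj ≤
              A * Phq (m' + 1) n Xj := by
            refine mul_le_mul_of_nonneg_right ?_ (by linarith [hΦ1 j])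
            rw [hAdef]
            refine mul_le_mul_of_nonneg_left ?_ (by positivity)
            nlinarith [pow_nonneg hσ₀0 (k + 1)]
          have key := le_trans hA' h
          rw [div_mul_eq_mul_div, div_mul_eq_mul_div, div_le_iff₀ hcS] at key
          calc (H.totalDegree : ℝ) * Lq' ≤ cdq (m' + 1) n * Phq (m' + 1) n Xj * Lq' :=
                mul_le_mul_of_nonneg_right hdeg hLq0
            _ ≤ cSq (m' + 1) n * Psq (m' + 1) n Xj := by nlinarith [hΨ1 j, hcS]
        have hFsq : Real.exp (-((H.totalDegree : ℝ) * Lq')) ≤ formNorm H ^ 2 := by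
          refine le_trans (le_of_eq ?_) hlow
          rw [Real.exp_neg, ← Real.exp_log (pow_pos (by positivity : (0:ℝ) < ((q + 1 : ℕ) : ℝ)) _),
            Real.log_pow]
          push_cast
          rfl
        have hU : UF j = cSq (m' + 1) n * Psq (m' + 1) n Xj / 2 := hUF j
        have hgoal : Real.exp (-(cSq (m' + 1) n * Psq (m' + 1) n Xj)) ≤
            Real.exp (-UF j) * formNorm H := by
          have h2 : Real.exp (-(cSq (m' + 1) n * Psq (m' + 1) n Xj)) ^ 2 ≤
              (Real.exp (-UF j) * formNorm H) ^ 2 := by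
            rw [mul_pow, ← Real.exp_nat_mul, ← Real.exp_nat_mul]
            push_cast
            calc Real.exp (2 * -(cSq (m' + 1) n * Psq (m' + 1) n Xj))
                = Real.exp (2 * -UF j) * Real.exp (-(cSq (m' + 1) n * Psq (m' + 1) n Xj)) := by
                  rw [← Real.exp_add, hU]; ring_nf
              _ ≤ Real.exp (2 * -UF j) * Real.exp (-((H.totalDegree : ℝ) * Lq')) :=
                  mul_le_mul_of_nonneg_left (Real.exp_le_exp.mpr (neg_le_neg hdl))
                    (Real.exp_pos _).le
              _ ≤ Real.exp (2 * -UF j) * formNorm H ^ 2 :=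
                  mul_le_mul_of_nonneg_left hFsq (Real.exp_pos _).le
          exact (pow_le_pow_iff_left₀ (Real.exp_pos _).le
            (mul_nonneg (Real.exp_pos _).le hFpos.le) two_ne_zero).mp h2
        calc Real.exp (-(cSq (m' + 1) n * Psq (m' + 1) n Xj)) ≤ Real.exp (-UF j) * formNorm H := hgoal
          _ = Real.exp (-UF j) * formNorm H * 1 := (mul_one _).symm
          _ ≤ Real.exp (-UF j) * (formNorm H * projNorm xP ^ H.totalDegree) := by
              rw [← mul_assoc]
              exact mul_le_mul_of_nonneg_left hxd (mul_nonneg (Real.exp_pos _).le hFpos.le)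
    · -- no common zero in the projective ball `Dist(x, y) ≤ e^{-U(j-1)σ₀}`
      intro y hy hdist
      set r : ℝ := Real.exp (-(UF (j - 1) * σ₀)) with hr
      have hr0 : 0 < r := Real.exp_pos _
      have hr1 : r * projNorm xP ≤ 1 / 2 := by
        have h1 : r ≤ Real.exp (-(σ₀ / 2)) := by
          rw [hr]; refine Real.exp_le_exp.mpr ?_
          have := hUFhalf (j - 1)
          nlinarith
        have h2 : Real.exp (-(σ₀ / 2)) ≤ Real.exp (-Lx) := Real.exp_le_exp.mpr (by
          have : 0 ≤ 2 / cSq (m' + 1) n * (16 * ((n : ℝ) + 1) * g' + Lx2) := by positivity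
          linarith)
        have h3 : Real.exp (-Lx) ≤ Real.exp (-Real.log (2 * projNorm xP)) :=
          Real.exp_le_exp.mpr (neg_le_neg (le_abs_self _))
        have h4 : Real.exp (-Real.log (2 * projNorm xP)) = 1 / (2 * projNorm xP) := by
          rw [Real.exp_neg, Real.exp_log (by positivity), one_div]
        have h5 : r ≤ 1 / (2 * projNorm xP) := by linarith [h1.trans (h2.trans h3)]
        rw [le_div_iff₀ (by positivity)] at h5
        linarith
      have hr4 : 4 * (r * projNorm xP) ^ 2 ≤ 1 := by
        have : 0 ≤ r * projNorm xP := by positivity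
        nlinarith
      have hΨstep : Psq (m' + 1) n Xj ≤ g' * Psq (m' + 1) n (((j - 1 : ℕ) : ℝ) + N₁) := by
        have hΨXj : 1 ≤ Psq (m' + 1) n Xj := hΨ1 j
        rcases Nat.eq_zero_or_pos j with hj0 | hjpos
        · have e : (((j - 1 : ℕ) : ℝ)) + N₁ = Xj := by rw [hXj, hj0]
          rw [e]
          exact le_mul_of_one_le_left (by linarith) hg'1
        · have hXj' : Xj = (((j - 1 : ℕ) : ℝ) + N₁) + 1 := by
            rw [hXj, Nat.cast_sub hjpos]; push_cast; ring
          rw [hXj']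
          exact scale_add_one_le (by positivity) zero_le_one (hX2 _)
      have hρ : rhoq (m' + 1) n Xj = 16 * ((n : ℝ) + 1) * Psq (m' + 1) n Xj := rfl
      have hB2 : 2 * r * projNorm xP ^ 2 ≤ Real.exp (-rhoq (m' + 1) n Xj) := by
        have hx2 : 0 < 2 * projNorm xP ^ 2 := by positivity
        have hlhs : 2 * r * projNorm xP ^ 2 =
            Real.exp (Real.log (2 * projNorm xP ^ 2) - UF (j - 1) * σ₀) := by
          rw [Real.exp_sub, Real.exp_log hx2, hr, Real.exp_neg, div_eq_mul_inv]; ring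
        rw [hlhs, Real.exp_le_exp, hρ]
        set Ψ' := Psq (m' + 1) n (((j - 1 : ℕ) : ℝ) + N₁) with hΨ'
        have hΨ'1 : 1 ≤ Ψ' := hΨ1 _
        have hU' : UF (j - 1) = cSq (m' + 1) n * Ψ' / 2 := hUF _
        have hσlow : 2 / cSq (m' + 1) n * (16 * ((n : ℝ) + 1) * g' + Lx2) ≤ σ₀ := by
          rw [hσ₀]; linarith
        have h1 : UF (j - 1) * σ₀ ≥ Ψ' * (16 * ((n : ℝ) + 1) * g' + Lx2) := by
          rw [hU']
          calc cSq (m' + 1) n * Ψ' / 2 * σ₀ ≥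
              cSq (m' + 1) n * Ψ' / 2 * (2 / cSq (m' + 1) n * (16 * ((n : ℝ) + 1) * g' + Lx2)) :=
                mul_le_mul_of_nonneg_left hσlow (by positivity)
            _ = Ψ' * (16 * ((n : ℝ) + 1) * g' + Lx2) := by field_simp
        have h2 : Real.log (2 * projNorm xP ^ 2) ≤ Lx2 * Ψ' :=
          (le_abs_self _).trans (le_mul_of_one_le_right hLx20 hΨ'1)
        have h3 : 16 * ((n : ℝ) + 1) * Psq (m' + 1) n Xj ≤ 16 * ((n : ℝ) + 1) * g' * Ψ' := by
          rw [mul_assoc (16 * ((n : ℝ) + 1))]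
          exact mul_le_mul_of_nonneg_left hΨstep (by positivity)
        nlinarith
      -- the polydisc around `θ''`, the corresponding point of `𝓑_ρ` around `θ`, and a
      -- non-vanishing member of the family there
      obtain ⟨hy0, hclose⟩ := polydisc_of_sineDist_le θq hy hr0.le hr4 hdist
      set z : Fin q → ℂ := fun i => y i.succ / y 0 with hz
      set z' : Var (m' + 1) n → ℂ := Sum.elim v (fun p => z (eV (Sum.inr p))) with hz'
      have hball : InBall u v Xj z' := fun x => by
        cases x with
        | inl k' => simp [hz', le_of_lt (Real.exp_pos _)]
        | inr p =>
          rw [norm_sub_rev]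
          have := (hclose (eV (Sum.inr p))).trans hB2
          have e1 : θq (eV (Sum.inr p)) = theta u v (Sum.inr p) := by simp [hθq, hθ₀]
          simpa [hz', hz, e1] using this
      obtain ⟨i, hi⟩ := hGj.exists_ne_zero hball
      refine ⟨Fintype.equivFin _ i, ?_⟩
      dsimp only
      rw [Equiv.symm_apply_apply]
      set H := homog (rename eV (famPoly u v Xj i)) with hH
      have hHhom : H.IsHomogeneous (rename eV (famPoly u v Xj i)).totalDegree := isHomogeneous_homog _
      have hyy : y = (y 0) • ((y 0)⁻¹ • y) := by
        rw [smul_smul, mul_inv_cancel₀ hy0, one_smul]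
      have hy' : (y 0)⁻¹ • y = Fin.cons 1 z := by
        funext i
        refine Fin.cases ?_ (fun i' => ?_) i
        · simp [hy0]
        · simp [hz, div_eq_inv_mul]
      rw [hyy, aeval_smul_of_isHomogeneous hHhom, hy', hH, aeval_homog_cons_one, aeval_rename,
        aeval_famPoly_congr (θ₂ := z') (fun p => by simp [hz']) i]
      exact mul_ne_zero (pow_ne_zero _ hy0) hi
  -- conclusion: `ℚ(x₁/x₀, …, x_q/x₀) = ℚ(θ'') = ℚ(e^{uv})` and `k + 1 = [mn/(m+n)]`
  have hrange : (Set.range fun i : Fin q => xP i.succ / xP 0) = Set.range θq := by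
    congr 1
    funext i
    simp [hxP]
  have hr : Set.range θq =
      insert 0 (Set.range fun p : Fin n × Fin (m' + 1) => Complex.exp (u p.1 * v p.2)) := by
    rw [hθq, eV.symm.surjective.range_comp, hθ₀, Set.Sum.elim_range, Set.range_const,
      Set.singleton_union]
  have hfin : (((((m' + 1) * n) / ((m' + 1) + n) : ℕ)) : Cardinal) ≤
      Algebra.trdeg ℚ ↥(IntermediateField.adjoin ℚ (Set.range θq)) := by
    rw [← hk1, ← trdeg_adjoin_congr hrange]; exact main
  refine hfin.trans_eq ?_
  rw [trdeg_adjoin_congr hr, adjoin_insert_zero_eq]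

/-- **Diaz 1989, Théorème 2, from LNM 1752 Ch. 8 Corollary 1.1 and the zero lemma.** Same
architecture as `Diaz1989_thm2_of_criterion` (`DiazThm2Proofs.lean`), the criterion being now
Philippon's in the form of LNM 1752 Ch. 8 Cor. 1.1, applied at the projective point
`x = (1 : θ'')`, `θ'' = (0, …, 0, e^{u_hv_k})`, to the homogenised family.
[cite: Diaz1989, Théorème 2, p. 2; §II-4-3 p. 16]
[cite: NesterenkoPhilippon2001, Ch. 8 §1 Corollary 1.1 (PDF pp. 165–166)] -/
theorem Diaz1989_thm2_of_ch8 (hC : NesterenkoPhilippon2001_ch8_cor_1_1) (hZ : Diaz1989_zeroLemma) :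
    Diaz1989_thm2 := by
  intro n m u v hu hv hA hB hmn
  have hm2 : 2 ≤ m := by
    rcases Nat.lt_or_ge m 2 with h | h
    · have : m * n ≤ 1 * n := Nat.mul_le_mul_right n (by omega)
      omega
    · exact h
  have hn2 : 2 ≤ n := by
    rcases Nat.lt_or_ge n 2 with h | h
    · have : m * n ≤ m * 1 := Nat.mul_le_mul_left m (by omega)
      omega
    · exact h
  have hn : 1 ≤ n := by omega
  obtain ⟨m', rfl⟩ : ∃ m', m = m' + 1 := ⟨m - 1, by omega⟩
  have hm' : 1 ≤ m' := by omega
  obtain ⟨c, hc, hZc⟩ := exists_zeroLemmaAt hZ n hn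
  have hmc : ((m' + 1 : ℕ) : ℝ) = (m' : ℝ) + 1 := by push_cast; ring
  have hηa : (0 : ℝ) ≤ ((m' + 1 : ℕ) * n : ℝ) / (2 * (m' + 1 : ℕ) + n) := by positivity
  have hηa' : (2 * ((m' + 1 : ℕ) : ℝ) + n) * (((m' + 1 : ℕ) * n : ℝ) / (2 * (m' + 1 : ℕ) + n)) ≤
      (m' + 1 : ℕ) * n := by
    rw [hmc]
    have hd : (0 : ℝ) < 2 * ((m' : ℝ) + 1) + n := by positivity
    rw [mul_div_cancel₀ _ hd.ne']
  have hηb : (0 : ℝ) ≤ ((m' + 1 : ℕ) * n : ℝ) / ((m' + 1 : ℕ) + 2 * n) := by positivity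
  have hηb' : (((m' + 1 : ℕ) : ℝ) + 2 * n) * (((m' + 1 : ℕ) * n : ℝ) / ((m' + 1 : ℕ) + 2 * n)) ≤
      (m' + 1 : ℕ) * n := by
    rw [hmc]
    have hd : (0 : ℝ) < ((m' : ℝ) + 1) + 2 * n := by positivity
    rw [mul_div_cancel₀ _ hd.ne']
  exact le_trdeg_of_eventually_goodX_ch8' hC hmn u v
    (eventually_goodX u v hm' hn hmn hc hZc hu hv hA hB hηa hηa' hηb hηb')

end Assembly

section Corollaries

/-- **Diaz 1989, Théorème 2, from LNM 1752 Ch. 8 Cor. 1.1 and Philippon's zero estimate on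
`𝔾ₐ × 𝔾ₘⁿ`** (the zero lemma being `Diaz1989_zeroLemma_of_P1n`). [cite: Diaz1989, Théorème 2, p. 2] -/
theorem Diaz1989_thm2_of_ch8_P1n (hC : NesterenkoPhilippon2001_ch8_cor_1_1)
    (hZ : Philippon1986_GaGm_P1n) : Diaz1989_thm2 :=
  Diaz1989_thm2_of_ch8 hC (Diaz1989_zeroLemma_of_P1n hZ)

/-- LNM 1752, Ch. 14, Thm 2.7, clause `t` (under (T.H.)) from Ch. 8 Cor. 1.1 and the zero lemma.
[cite: NesterenkoPhilippon2001, Ch. 14 Thm 2.7 (t), p. 248] -/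
theorem Diaz1989_grid_of_ch8 (hC : NesterenkoPhilippon2001_ch8_cor_1_1) (hZ : Diaz1989_zeroLemma) :
    Diaz1989_grid :=
  Diaz1989_grid_of_thm2 (Diaz1989_thm2_of_ch8 hC hZ)

/-- `Diaz1989_grid` (LNM 1752 Ch. 14 Thm 2.7, clause `t`) from LNM 1752 Ch. 8 Cor. 1.1 and
Philippon's zero estimate. [cite: NesterenkoPhilippon2001, Ch. 14 Thm 2.7 (t), p. 248] -/
theorem Diaz1989_grid_of_ch8_P1n (hC : NesterenkoPhilippon2001_ch8_cor_1_1)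
    (hZ : Philippon1986_GaGm_P1n) : Diaz1989_grid :=
  Diaz1989_grid_of_thm2 (Diaz1989_thm2_of_ch8_P1n hC hZ)

end Corollaries

end Literature.NumberTheory.Transcendental

end
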